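import Literature.Analysis.FluidPDE.ScalarFourierData
import HarnessLib

/-!
# Fourier-side objects for the linearised, stress-forced Navier–Stokes system (3.2) on `T^d`: definitions

Analysis/FluidPDE definition file, first of the files discharging the named fact
`Literature.Analysis.FluidPDE.Torus.CheskidovLuo2022LocalExistence`
(`NavierStokesConcentrationCorrectorFacts`; Cheskidov–Luo 2022, arXiv:2009.06596, §3.1: "thanks to
the general local wellposedness theory of the Navier–Stokes equations … for all sufficiently
small `τ > 0`, we may solve equation (3.2) on intervals `[tᵢ, tᵢ₊₁]` to obtain a unique smooth
solution `vᵢ`", with the smallness `‖vᵢ‖ ≤ δ` of Prop. 3.2), i.e. local smooth solvability of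

  `∂ₜv + (v·∇)v + (u·∇)v + (v·∇)u + ∇q = Δv - div R`, `div v = 0`, `v(a) = 0`

on short intervals. As for Leray's theorem on `ℝ³` (`NSFourier*`) and for the scalar
advection–diffusion equation on `T^d` (`ScalarFourier*`, whose lattice toolkit — `lconv`,
`dsym`, `transportSym`, `heatFactor`, coefficient families, `torusSynth` — is reused verbatim),
the solution is constructed on the Fourier side. The unknown is the family of coefficient
fields `c l t k = 𝓕(vₗ(t))(k)` (component `l : d`, time `t`, frequency `k : ℤ^d`), and with the
drift coefficients `Uⱼ = ûⱼ` and the stress coefficients `RH l j = 𝓕(Rₗⱼ)`: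

* `convSym U RH c l k` — the coefficients of the **convective terms plus the stress forcing**,
  `𝓕((v·∇)vₗ + (u·∇)vₗ + (v·∇)uₗ + (div R)ₗ)(k)
    = N(c, cₗ) + N(U, cₗ) + N(c, Uₗ) + ∑ⱼ 2πikⱼ RHₗⱼ`
  (`N = ScalarFourier.transportSym`, products ↦ lattice convolutions, `∂ⱼ ↦ 2πikⱼ`);
* `leraySym l m k = δₗₘ - kₗkₘ/|k|²` — the Leray projector (`|0|² = 0` and Lean's `x/0 = 0` make
  it the identity at `k = 0`); `projSym = leraySym · convSym` — the projected right-hand side;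
  `presCoef` — the pressure coefficients `q̂(k) = -(∑ₘ kₘ Gₘ(k)) / (2πi|k|²)`, for which
  `-projSym + convSym + 2πikₗ q̂ = 0` identically (the Fourier form of `ℙ = 1 - ∇Δ⁻¹div`);
* `picardMap θ U RH c` — the clamped Duhamel map of the mild formulation with zero datum and
  viscosity `1` on `[0, θ]`,
  `Φ(c)(l, t, k) = -∫₀^τ e^{-4π²|k|²(τ-s)} projSym(U(s), RH(s), c(s))(l, k) ds`, `τ = clamp θ t`;
  `picardIter`, `picardLim` — its iterates from `0` and their pointwise limit;
* `DataHyp θ U RH` — the hypotheses on the Fourier-side data (continuity in time, every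
  polynomial decay uniformly in time; `0 < θ ≤ 1`);
* `convFamily`, `projFamily`, `bootRHS` — the candidate families of time derivatives (Leibniz
  families of the convolutions, `ScalarFourier.transportFamily`), for the bootstrap of time
  regularity.

All estimates are in the sequel files (`CorrectorFourierEstimates`, `…Picard`, `…Regularity`,
`…Solution`).

## References

* A. Cheskidov, X. Luo, *Sharp nonuniqueness for the Navier–Stokes equations*, Invent. Math. 229
  (2022) = arXiv:2009.06596, §3.1 (3.2), Prop. 3.2. [`CheskidovLuo2022`]
* P. G. Lemarié-Rieusset, *The Navier–Stokes problem in the 21st century*, CRC 2016, §6.1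
  (Leray projector as a Fourier multiplier), §8.5 (mild formulation in weighted sup-norms).
* L. Grafakos, *Classical Fourier Analysis*, 3rd ed. (2014), Prop. 3.2.6 (8), §3.3.1. [`Grafakos2014`]
-/

noncomputable section

open MeasureTheory Real Set Filter Topology UnitAddTorus

namespace Literature.Analysis.FluidPDE

namespace CorrectorFourier

open ScalarFourier
open FourierNS (HasDecay clamp)
open Literature.Analysis.FunctionSpaces.Torus (freqNormSq)

variable {d : Type*} [Fintype d]

/-! ### The symbols -/

section Symbols

/-- The **Leray projector entries** `P(k)ₗₘ = δₗₘ - kₗkₘ/|k|²` on the lattice (`|k|² = freqNormSq k`;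
at `k = 0` the quotient is Lean's `0/0 = 0`, so `P(0) = 1`), cast to `ℂ` (Lemarié-Rieusset 2016,
§6.1). [folklore] -/
def leraySym [DecidableEq d] (l m : d) (k : d → ℤ) : ℂ :=
  (((if l = m then (1 : ℝ) else 0) - (k l : ℝ) * (k m : ℝ) / freqNormSq k : ℝ) : ℂ)

/-- Unfolding `leraySym`. [folklore] -/
theorem leraySym_apply [DecidableEq d] (l m : d) (k : d → ℤ) :
    leraySym l m k = (((if l = m then (1 : ℝ) else 0) - (k l : ℝ) * (k m : ℝ) / freqNormSq k : ℝ) : ℂ) :=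
  rfl

/-- The **convective symbol with stress forcing**: the Fourier coefficients of
`(v·∇)vₗ + (u·∇)vₗ + (v·∇)uₗ + ∑ⱼ ∂ⱼRₗⱼ` in terms of the coefficient fields `c` (of `v`), `U`
(of `u`) and `RH l j` (of `Rₗⱼ`): `N(c, cₗ) + N(U, cₗ) + N(c, Uₗ) + ∑ⱼ 2πikⱼ RHₗⱼ` with the
transport symbol `N = ScalarFourier.transportSym`. [folklore] -/
def convSym (U : d → (d → ℤ) → ℂ) (RH : d → d → (d → ℤ) → ℂ) (c : d → (d → ℤ) → ℂ) (l : d)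
    (k : d → ℤ) : ℂ :=
  transportSym c (c l) k + transportSym U (c l) k + transportSym c (U l) k + ∑ j, dsym j k * RH l j k

/-- Unfolding `convSym`. [folklore] -/
theorem convSym_apply (U : d → (d → ℤ) → ℂ) (RH : d → d → (d → ℤ) → ℂ) (c : d → (d → ℤ) → ℂ)
    (l : d) (k : d → ℤ) :
    convSym U RH c l k =
      transportSym c (c l) k + transportSym U (c l) k + transportSym c (U l) k +
        ∑ j, dsym j k * RH l j k :=
  rfl

/-- The **Leray-projected right-hand side** `(P(k) G(k))ₗ = ∑ₘ P(k)ₗₘ Gₘ(k)`. [folklore] -/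
def projSym [DecidableEq d] (U : d → (d → ℤ) → ℂ) (RH : d → d → (d → ℤ) → ℂ)
    (c : d → (d → ℤ) → ℂ) (l : d) (k : d → ℤ) : ℂ :=
  ∑ m, leraySym l m k * convSym U RH c m k

/-- Unfolding `projSym`. [folklore] -/
theorem projSym_apply [DecidableEq d] (U : d → (d → ℤ) → ℂ) (RH : d → d → (d → ℤ) → ℂ)
    (c : d → (d → ℤ) → ℂ) (l : d) (k : d → ℤ) :
    projSym U RH c l k = ∑ m, leraySym l m k * convSym U RH c m k :=
  rfl

/-- The **pressure coefficients** `q̂(k) = -(∑ₘ kₘ Gₘ(k)) / (2πi |k|²)` (`q̂(0) = 0` by `x/0 = 0`):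
the solution of `2πi|k|² q̂ = -∑ₘ kₘ Gₘ`, i.e. of `Δq = -div G` (Lemarié-Rieusset 2016, §6.1). [folklore] -/
def presCoef (U : d → (d → ℤ) → ℂ) (RH : d → d → (d → ℤ) → ℂ) (c : d → (d → ℤ) → ℂ)
    (k : d → ℤ) : ℂ :=
  -(∑ m, (k m : ℂ) * convSym U RH c m k) / (2 * π * Complex.I * (freqNormSq k : ℂ))

/-- Unfolding `presCoef`. [folklore] -/
theorem presCoef_apply (U : d → (d → ℤ) → ℂ) (RH : d → d → (d → ℤ) → ℂ) (c : d → (d → ℤ) → ℂ)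
    (k : d → ℤ) :
    presCoef U RH c k =
      -(∑ m, (k m : ℂ) * convSym U RH c m k) / (2 * π * Complex.I * (freqNormSq k : ℂ)) :=
  rfl

end Symbols

/-! ### The Picard iteration on `[0, θ]` -/

section Picard

variable [DecidableEq d]

/-- The **clamped Duhamel (Picard) map** of the mild formulation of (3.2) with zero datum and
viscosity `1` on `[0, θ]`: with `τ = clamp θ t`,
`Φ(c)(l, t, k) = -∫₀^τ e^{-4π²|k|²(τ-s)} projSym(U(s), RH(s), c(s))(l, k) ds`
(on `[0, θ]` the genuine Duhamel formula for `∂ₜcₗ = -4π²|k|² cₗ - (P G)ₗ`). [folklore] -/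
def picardMap (θ : ℝ) (U : d → ℝ → (d → ℤ) → ℂ) (RH : d → d → ℝ → (d → ℤ) → ℂ)
    (c : d → ℝ → (d → ℤ) → ℂ) (l : d) (t : ℝ) (k : d → ℤ) : ℂ :=
  -∫ s in (0 : ℝ)..clamp θ t, (heatFactor 1 k (clamp θ t - s) : ℂ) *
    projSym (fun j => U j s) (fun i j => RH i j s) (fun j => c j s) l k

/-- The **Picard iterates** `c₀ = 0`, `cₙ₊₁ = Φ(cₙ)`. [folklore] -/
def picardIter (θ : ℝ) (U : d → ℝ → (d → ℤ) → ℂ) (RH : d → d → ℝ → (d → ℤ) → ℂ) :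
    ℕ → d → ℝ → (d → ℤ) → ℂ
  | 0 => fun _ _ _ => 0
  | n + 1 => picardMap θ U RH (picardIter θ U RH n)

/-- `c₀ = 0`. [folklore] -/
@[simp]
theorem picardIter_zero (θ : ℝ) (U : d → ℝ → (d → ℤ) → ℂ) (RH : d → d → ℝ → (d → ℤ) → ℂ) :
    picardIter θ U RH 0 = fun _ _ _ => 0 := rfl

/-- `cₙ₊₁ = Φ(cₙ)`. [folklore] -/
theorem picardIter_succ (θ : ℝ) (U : d → ℝ → (d → ℤ) → ℂ) (RH : d → d → ℝ → (d → ℤ) → ℂ)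
    (n : ℕ) : picardIter θ U RH (n + 1) = picardMap θ U RH (picardIter θ U RH n) := rfl

/-- The **Picard limit** `c(l, t, k) = limₙ cₙ(l, t, k)` (pointwise `limUnder`; the genuine limit
once the iteration contracts, file `CorrectorFourierPicard`). [folklore] -/
def picardLim (θ : ℝ) (U : d → ℝ → (d → ℤ) → ℂ) (RH : d → d → ℝ → (d → ℤ) → ℂ)
    (l : d) (t : ℝ) (k : d → ℤ) : ℂ :=
  limUnder atTop fun n => picardIter θ U RH n l t k

/-- **Hypotheses on the Fourier-side data**: the interval length `0 < θ ≤ 1`; the drift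
coefficients `Uⱼ(t)` and the stress coefficients `RH l j (t)` are continuous in `t ∈ ℝ` at
every frequency and have every polynomial decay uniformly in `t ∈ ℝ` (in the application they
are the coefficients of the smooth background `u`, `R` at clamped, translated time). [folklore] -/
structure DataHyp (θ : ℝ) (U : d → ℝ → (d → ℤ) → ℂ) (RH : d → d → ℝ → (d → ℤ) → ℂ) : Prop where
  /-- positive interval length -/
  hθ : 0 < θ
  /-- interval length at most one -/
  hθ1 : θ ≤ 1
  /-- the drift coefficients are continuous in time at each frequency -/
  contU : ∀ j m, Continuous fun t => U j t m
  /-- every polynomial decay of the drift coefficients, uniformly in time and component -/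
  decayU : ∀ K : ℕ, ∃ A : ℝ, ∀ j t, HasDecay K A (U j t)
  /-- the stress coefficients are continuous in time at each frequency -/
  contR : ∀ i j m, Continuous fun t => RH i j t m
  /-- every polynomial decay of the stress coefficients, uniformly in time and entry -/
  decayR : ∀ K : ℕ, ∃ B : ℝ, ∀ i j t, HasDecay K B (RH i j t)

end Picard

/-! ### Families of time derivatives -/

section Family

/-- The **convective family**: the candidate for `∂ₜⁱ convSym` along families `UF ⱼ` (drift),
`RF l j` (stress) and `CF l` (velocity components) — Leibniz families of the three transport
symbols (`ScalarFourier.transportFamily`) plus the differentiated forcing. [folklore] -/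
def convFamily (UF : d → ℕ → ℝ → (d → ℤ) → ℂ) (RF : d → d → ℕ → ℝ → (d → ℤ) → ℂ)
    (CF : d → ℕ → ℝ → (d → ℤ) → ℂ) (l : d) : ℕ → ℝ → (d → ℤ) → ℂ :=
  fun i t k => transportFamily CF (CF l) i t k + transportFamily UF (CF l) i t k +
    transportFamily CF (UF l) i t k + ∑ j, dsym j k * RF l j i t k

/-- `convFamily` at order `0` is `convSym` of the zeroth members. [folklore] -/
@[simp]
theorem convFamily_zero (UF : d → ℕ → ℝ → (d → ℤ) → ℂ) (RF : d → d → ℕ → ℝ → (d → ℤ) → ℂ)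
    (CF : d → ℕ → ℝ → (d → ℤ) → ℂ) (l : d) (t : ℝ) (k : d → ℤ) :
    convFamily UF RF CF l 0 t k =
      convSym (fun j => UF j 0 t) (fun i j => RF i j 0 t) (fun j => CF j 0 t) l k := by
  simp [convFamily, convSym]

variable [DecidableEq d]

/-- The **projected family**: `∑ₘ P(k)ₗₘ · convFamily m` (the projector is time independent). [folklore] -/
def projFamily (UF : d → ℕ → ℝ → (d → ℤ) → ℂ) (RF : d → d → ℕ → ℝ → (d → ℤ) → ℂ)
    (CF : d → ℕ → ℝ → (d → ℤ) → ℂ) (l : d) : ℕ → ℝ → (d → ℤ) → ℂ :=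
  fun i t k => ∑ m, leraySym l m k * convFamily UF RF CF m i t k

/-- `projFamily` at order `0` is `projSym` of the zeroth members. [folklore] -/
@[simp]
theorem projFamily_zero (UF : d → ℕ → ℝ → (d → ℤ) → ℂ) (RF : d → d → ℕ → ℝ → (d → ℤ) → ℂ)
    (CF : d → ℕ → ℝ → (d → ℤ) → ℂ) (l : d) (t : ℝ) (k : d → ℤ) :
    projFamily UF RF CF l 0 t k =
      projSym (fun j => UF j 0 t) (fun i j => RF i j 0 t) (fun j => CF j 0 t) l k := by
  simp [projFamily, projSym]

/-- The **right-hand side of the differentiated mild system** along a velocity family `CF`: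
`(bootRHS UF RF CF) l i = -4π²|k|² CF l i - projFamily l i`, the candidate for `∂ₜ (CF l i)`
when `CF l 0 = cₗ` solves `∂ₜcₗ = -4π²|k|² cₗ - (P G)ₗ`. [folklore] -/
def bootRHS (UF : d → ℕ → ℝ → (d → ℤ) → ℂ) (RF : d → d → ℕ → ℝ → (d → ℤ) → ℂ)
    (CF : d → ℕ → ℝ → (d → ℤ) → ℂ) (l : d) : ℕ → ℝ → (d → ℤ) → ℂ :=
  fun i t k => -(heatRate 1 k : ℂ) * CF l i t k - projFamily UF RF CF l i t k

/-- Unfolding `bootRHS`. [folklore] -/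
theorem bootRHS_apply (UF : d → ℕ → ℝ → (d → ℤ) → ℂ) (RF : d → d → ℕ → ℝ → (d → ℤ) → ℂ)
    (CF : d → ℕ → ℝ → (d → ℤ) → ℂ) (l : d) (i : ℕ) (t : ℝ) (k : d → ℤ) :
    bootRHS UF RF CF l i t k = -(heatRate 1 k : ℂ) * CF l i t k - projFamily UF RF CF l i t k :=
  rfl

end Family

end CorrectorFourier

end Literature.Analysis.FluidPDE

end
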